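import Summits.ResolutionOfSingularities.ResolutionOfSingularities.Theorems.HilbertSamuelEliminationSigmaMaxModificationsCorridor3WLadderIsoInsepE2NearCubic
import Summits.ResolutionOfSingularities.ResolutionOfSingularities.Theorems.HilbertSamuelEliminationSigmaMaxModificationsCorridor3WLadderIsoInsepE2NearSquare
import HarnessLib

/-!
# [OURS · L1 W4.2] E2 chart calculus, brick 14: (N3b) IN THE CHART — the reduction `R[𝔪/c_j] → κ[T_k : k ≠ j]` of the point and
# «ē = 3 at the next point ⇒ the restricted cubic lies in the SYMBOLIC SQUARE `𝔭⁽²⁾`» (crux chain w42, cell k2 `T3insep` =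
# `stub_isoInsepTower`; `--supports stmt-ResolutionOfSingularities-19249`)

OURS (cell res-hironaka, slot W4.2, seat res-D-pv-042; OWN OBJECT TUO 18:19Z, (N3) continuation); NOT a statement of [Hironaka2017]
nor of [CossartJannsenSaito2020] / [CossartPiltant2008]. AI-drafted, weaker than expert review. PROOF file, def-free, fact-free.

* `exists_chartReduction` — THE REDUCTION DICTIONARY of brick 9 made reusable: for `R` regular local with regular parameters `c`, a chart
  `j` and a prime `𝔔` of `B = R[𝔪/c_j]` over `𝔪`, there are a surjection `π : B ↠ κ[T_k : k ≠ j]` with `π|_R = residue`, `π(c_k/c_j) = T_k`,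
  `ker π = (c_j/1)`, and the prime `𝔭 = π(𝔔)` with `π⁻¹𝔭 = 𝔔` (Stacks 0BIQ: `B/c_jB ≅ κ[T_k : k ≠ j]`).
* `reduction_coneTransform_mem_maximalIdeal_sq` — brick 13 applied in `B_𝔔` (with a hypersurface presentation `σ′ : B_𝔔 ↠ A` of
  the next stalk, `ker σ′ = (h′/1)`, `h′/1` of order two, `char κ(A) = 2`, `ē(A) + 1 = emb.dim B_𝔔`, and `u, v ∈ 𝔔`:
  `F(c/c_j)/1 ∈ (c_j/1) + 𝔪²` in `B_𝔔`) and pushed through `B_𝔔 → κ[T]_𝔭`: **`π(F(c/c_j)) ∈ 𝔭²κ[T]_𝔭`**, i.e. the reduced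
  cubic `F̄₃(T̃)` (`T̃_j = 1`) lies in the symbolic square of the point `𝔭 ∋ T_{i₀}, T_{i₁}` of the line.
-/

noncomputable section

set_option linter.dupNamespace false

open scoped Classical
open IsLocalRing MvPolynomial Literature.AlgebraicGeometry.Resolution Literature.RingTheory.HilbertSamuel
open Summit.ResolutionOfSingularities.ResolutionOfSingularities.Cruxes.SigmaMaxModifications.IdeasL1C5.EmbeddedStep
  (span_range_append_elim0 isRegularRing_blowupAlgebra_rsop)

namespace Summit.ResolutionOfSingularities.ResolutionOfSingularities.Cruxes.SigmaMaxModifications.IdeasL1C6.E2Chart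

universe u

/-! ## §1. The reduction dictionary `R[𝔪/c_j] ↠ κ[T_k : k ≠ j]` at a point over `𝔪` -/

/-- **The reduction dictionary.** `R` regular local with regular parameters `c : Fin d → R`, `B = R[𝔪/c_j]`, `𝔔` a prime of `B` over
`𝔪_R`. There are a SURJECTION `π : B ↠ κ[T_k : k ≠ j]` with `π(r/1) = r̄`, `π(c_k/c_j) = T_k` (`k ≠ j`), `π(c_j/1) = 0`,
`ker π = (c_j/1)`, and the prime `𝔭 := π(𝔔)` with `π⁻¹(𝔭) = 𝔔`. [cite: StacksProject, Tag 0BIQ] -/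
theorem exists_chartReduction {R : Type u} [CommRing R] [IsRegularLocalRing R] {d : ℕ}
    (hd : (maximalIdeal R).spanFinrank = d) (c : Fin d → R) (hc : Ideal.span (Set.range c) = maximalIdeal R) (j : Fin d)
    (𝔔 : Ideal (blowupAlgebra (Ideal.span (Set.range c)) (c j))) [𝔔.IsPrime]
    (h𝔔 : 𝔔.comap (algebraMap R (blowupAlgebra (Ideal.span (Set.range c)) (c j))) = maximalIdeal R) :
    ∃ (π : blowupAlgebra (Ideal.span (Set.range c)) (c j) →+* MvPolynomial {k : Fin d // k ≠ j} (ResidueField R))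
      (𝔭 : Ideal (MvPolynomial {k : Fin d // k ≠ j} (ResidueField R))) (_ : 𝔭.IsPrime),
      Function.Surjective π ∧
      (∀ a : R, π (algebraMap R (blowupAlgebra (Ideal.span (Set.range c)) (c j)) a) = C (residue R a)) ∧
      (∀ (k : Fin d) (hk : k ≠ j), π (blowupAlgebra.frac c j k) = X ⟨k, hk⟩) ∧
      π (algebraMap R (blowupAlgebra (Ideal.span (Set.range c)) (c j)) (c j)) = 0 ∧
      RingHom.ker π = Ideal.span {algebraMap R (blowupAlgebra (Ideal.span (Set.range c)) (c j)) (c j)} ∧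
      𝔭 = 𝔔.map π ∧ 𝔭.comap π = 𝔔 := by
  have hqr : IsQuasiRegular c := isQuasiRegular_centre c Fin.elim0 (span_range_append_elim0 c hc) hd
  obtain ⟨ρ, hρ⟩ : ∃ ρ : (R ⧸ Ideal.span (Set.range c)) ≃+* ResidueField R,
      ∀ a : R, ρ (Ideal.Quotient.mk _ a) = residue R a :=
    ⟨Ideal.quotEquivOfEq hc, fun a => Ideal.quotEquivOfEq_mk _ _⟩
  obtain ⟨π, hπe, hπsurj⟩ : ∃ π : blowupAlgebra (Ideal.span (Set.range c)) (c j) →+* MvPolynomial {k : Fin d // k ≠ j} (ResidueField R),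
      (∀ z, π z = MvPolynomial.map (ρ : (R ⧸ Ideal.span (Set.range c)) →+* ResidueField R)
        (blowupAlgebra.quotientSpanEquiv c j hqr
          (Ideal.Quotient.mk (Ideal.span {algebraMap R (blowupAlgebra (Ideal.span (Set.range c)) (c j)) (c j)}) z))) ∧ Function.Surjective π :=
    ⟨(mapEquiv {k : Fin d // k ≠ j} ρ).toRingHom.comp
        ((blowupAlgebra.quotientSpanEquiv c j hqr).toRingHom.comp (Ideal.Quotient.mk _)),
      fun z => rfl,
      (mapEquiv {k : Fin d // k ≠ j} ρ).surjective.comp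
        ((blowupAlgebra.quotientSpanEquiv c j hqr).surjective.comp Ideal.Quotient.mk_surjective)⟩
  have hπalg : ∀ a : R, π (algebraMap R (blowupAlgebra (Ideal.span (Set.range c)) (c j)) a) = C (residue R a) := fun a => by
    rw [hπe, quotientSpanEquiv_mk_algebraMap c j hqr a, map_C, RingEquiv.coe_toRingHom, hρ]
  have hπfrac : ∀ (k : Fin d) (hk : k ≠ j), π (blowupAlgebra.frac c j k) = X ⟨k, hk⟩ := fun k hk => by
    rw [hπe, quotientSpanEquiv_mk_frac c j hqr ⟨k, hk⟩, map_X]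
  have hcj𝔔 : algebraMap R (blowupAlgebra (Ideal.span (Set.range c)) (c j)) (c j) ∈ 𝔔 := by
    have : c j ∈ 𝔔.comap (algebraMap R (blowupAlgebra (Ideal.span (Set.range c)) (c j))) := by
      rw [h𝔔, ← hc]; exact Ideal.subset_span (Set.mem_range_self j)
    exact this
  have hker : RingHom.ker π = Ideal.span {algebraMap R (blowupAlgebra (Ideal.span (Set.range c)) (c j)) (c j)} := by
    ext z
    rw [RingHom.mem_ker, hπe, map_eq_zero_iff _ (MvPolynomial.map_injective _ ρ.injective),
      map_eq_zero_iff _ (blowupAlgebra.quotientSpanEquiv c j hqr).injective, Ideal.Quotient.eq_zero_iff_mem]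
  have hπcj : π (algebraMap R (blowupAlgebra (Ideal.span (Set.range c)) (c j)) (c j)) = 0 := by
    rw [← RingHom.mem_ker, hker]; exact Ideal.mem_span_singleton_self _
  have hkerle : RingHom.ker π ≤ 𝔔 := by
    rw [hker]; exact (Ideal.span_singleton_le_iff_mem _).mpr hcj𝔔
  haveI h𝔭p : (𝔔.map π).IsPrime := Ideal.map_isPrime_of_surjective hπsurj hkerle
  have hcomap : (𝔔.map π).comap π = 𝔔 := by
    rw [Ideal.comap_map_of_surjective π hπsurj, ← RingHom.ker_eq_comap_bot]
    exact sup_eq_left.mpr hkerle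
  exact ⟨π, 𝔔.map π, h𝔭p, hπsurj, hπalg, hπfrac, hπcj, hker, rfl, hcomap⟩

/-! ## §3. Pushed to `κ[T]_𝔭`: the reduced cubic lies in the symbolic square of the point -/

/-- A local homomorphism kills nothing of `𝔪²`-membership: the image of `(t) + 𝔪_A²` under a local map `f` with `f t = 0` lies in `𝔪_B²`.
[folklore] -/
theorem map_mem_sq_of_mem_span_sup_sq {A' B' : Type*} [CommRing A'] [CommRing B'] [IsLocalRing A'] [IsLocalRing B']
    (f : A' →+* B') [IsLocalHom f] {t x : A'} (ht : f t = 0) (hx : x ∈ Ideal.span {t} ⊔ maximalIdeal A' ^ 2) :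
    f x ∈ maximalIdeal B' ^ 2 := by
  obtain ⟨a, ha, b, hb, rfl⟩ := Submodule.mem_sup.mp hx
  obtain ⟨r, rfl⟩ := Ideal.mem_span_singleton'.mp ha
  rw [map_add, map_mul, ht, mul_zero, zero_add]
  exact map_mem_maximalIdeal_sq f hb

/-- **(N3b) READ IN `κ[T]_𝔭`: the reduced cubic lies in the symbolic square of the point.** In the chart `B = R[𝔪/c_j]` of
`h = ĉ(c_{i₀}² + λ̂c_{i₁}²) + F(c)` (`F` a cubic form over `R`), at a prime `𝔔` over `𝔪_R` with `c_{i₀}/c_j, c_{i₁}/c_j ∈ 𝔔`, suppose the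
next stalk has a hypersurface presentation `σ′ : B_𝔔 ↠ A` with `ker σ′ = (h′/1)` (`h = c_j²h′`), `h′/1 ∈ 𝔪² ∖ 𝔪³`, residue
characteristic two and `ē(A) + 1 = emb.dim B_𝔔`.  Then (brick 13, with `t = c_j/1 ∉ 𝔪²` by brick 11) `F(c/c_j)/1 ∈ (c_j/1) + 𝔪²` in
`B_𝔔`, and there are the reduction `π : R[𝔪/c_j] ↠ κ[T_k : k ≠ j]` and the prime `𝔭 = π(𝔔)` of brick 14 §1, with
`T_{i₀}, T_{i₁} ∈ 𝔭` (for `i₀, i₁ ≠ j`) and **`π(F(c/c_j)) ∈ 𝔭²κ[T]_𝔭`**; here `π(F(c/c_j)) = F̄(T̃)` with `T̃_k = T_k` (`k ≠ j`), `T̃_j = 1`.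
[OURS · L1 W4.2 · k2 · E2 chart calculus, brick 14] [folklore] -/
theorem reduction_coneTransform_mem_maximalIdeal_sq {R : Type u} [CommRing R] [IsRegularLocalRing R] {d : ℕ}
    (hd : (maximalIdeal R).spanFinrank = d) (c : Fin d → R) (hc : Ideal.span (Set.range c) = maximalIdeal R)
    {i₀ i₁ : Fin d} {h cc lam : R} {F : MvPolynomial (Fin d) R} (hF : F.IsHomogeneous 3)
    (hFh : MvPolynomial.eval c F = h - cc * (c i₀ ^ 2 + lam * c i₁ ^ 2)) (j : Fin d)
    (𝔔 : Ideal (blowupAlgebra (Ideal.span (Set.range c)) (c j))) [𝔔.IsPrime] (h𝔔 : 𝔔.comap (algebraMap R (blowupAlgebra (Ideal.span (Set.range c)) (c j))) = maximalIdeal R)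
    (hu : blowupAlgebra.frac c j i₀ ∈ 𝔔) (hv : blowupAlgebra.frac c j i₁ ∈ 𝔔) {h' : blowupAlgebra (Ideal.span (Set.range c)) (c j)}
    (hh' : algebraMap R (blowupAlgebra (Ideal.span (Set.range c)) (c j)) h = algebraMap R (blowupAlgebra (Ideal.span (Set.range c)) (c j)) (c j) ^ 2 * h')
    {A : Type u} [CommRing A] [IsLocalRing A] [IsNoetherianRing A] [CharP (ResidueField A) 2]
    (σ' : Localization.AtPrime 𝔔 →+* A) (hσ' : Function.Surjective σ')
    (hker' : RingHom.ker σ' = Ideal.span {algebraMap (blowupAlgebra (Ideal.span (Set.range c)) (c j)) (Localization.AtPrime 𝔔) h'})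
    (hh'2 : algebraMap (blowupAlgebra (Ideal.span (Set.range c)) (c j)) (Localization.AtPrime 𝔔) h' ∈ maximalIdeal (Localization.AtPrime 𝔔) ^ 2)
    (hh'3 : algebraMap (blowupAlgebra (Ideal.span (Set.range c)) (c j)) (Localization.AtPrime 𝔔) h' ∉ maximalIdeal (Localization.AtPrime 𝔔) ^ 3)
    {d' : ℕ} (hd' : (maximalIdeal (Localization.AtPrime 𝔔)).spanFinrank = d') (hgeom : geomDirDim A + 1 = d') :
    ∃ (π : blowupAlgebra (Ideal.span (Set.range c)) (c j) →+* MvPolynomial {k : Fin d // k ≠ j} (ResidueField R)) (𝔭 : Ideal (MvPolynomial {k : Fin d // k ≠ j} (ResidueField R))) (_ : 𝔭.IsPrime),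
      Function.Surjective π ∧
      (∀ a : R, π (algebraMap R (blowupAlgebra (Ideal.span (Set.range c)) (c j)) a) = C (residue R a)) ∧
      (∀ (k : Fin d) (hk : k ≠ j), π (blowupAlgebra.frac c j k) = X ⟨k, hk⟩) ∧
      π (algebraMap R (blowupAlgebra (Ideal.span (Set.range c)) (c j)) (c j)) = 0 ∧
      RingHom.ker π = Ideal.span {algebraMap R (blowupAlgebra (Ideal.span (Set.range c)) (c j)) (c j)} ∧ 𝔭 = 𝔔.map π ∧ 𝔭.comap π = 𝔔 ∧
      π (blowupAlgebra.frac c j i₀) ∈ 𝔭 ∧ π (blowupAlgebra.frac c j i₁) ∈ 𝔭 ∧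
      π (MvPolynomial.aeval (blowupAlgebra.frac c j) F) ∈ 𝔭 ∧
      π (MvPolynomial.aeval (blowupAlgebra.frac c j) F) =
        MvPolynomial.aeval (fun k : Fin d => if hk : k = j then (1 : MvPolynomial {k : Fin d // k ≠ j} (ResidueField R)) else X ⟨k, hk⟩) (MvPolynomial.map (residue R) F) ∧
      algebraMap (MvPolynomial {k : Fin d // k ≠ j} (ResidueField R)) (Localization.AtPrime 𝔭) (π (MvPolynomial.aeval (blowupAlgebra.frac c j) F)) ∈
        maximalIdeal (Localization.AtPrime 𝔭) ^ 2 := by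
  obtain ⟨π, 𝔭, h𝔭p, hπsurj, hπalg, hπfrac, hπcj, hker, h𝔭, hcomap⟩ := exists_chartReduction hd c hc j 𝔔 h𝔔
  haveI := h𝔭p
  have hmem𝔭 : ∀ {z : blowupAlgebra (Ideal.span (Set.range c)) (c j)}, z ∈ 𝔔 → π z ∈ 𝔭 := fun {z} hz => by rw [h𝔭]; exact Ideal.mem_map_of_mem π hz
  have hcj𝔔 : algebraMap R (blowupAlgebra (Ideal.span (Set.range c)) (c j)) (c j) ∈ 𝔔 := by
    have : c j ∈ 𝔔.comap (algebraMap R (blowupAlgebra (Ideal.span (Set.range c)) (c j))) := by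
      rw [h𝔔, ← hc]; exact Ideal.subset_span (Set.mem_range_self j)
    exact this
  have hG𝔔 : MvPolynomial.aeval (blowupAlgebra.frac c j) F ∈ 𝔔 :=
    (strictTransform_mem_sq_iff_coneTransform_mem hd c hc hF hFh j 𝔔 hcj𝔔 hu hv hh').mp hh'2
  -- the value of `π` on the cone transform
  have hfracj : blowupAlgebra.frac c j j = 1 := blowupAlgebra.gen_self _ _ _
  have hπG : π (MvPolynomial.aeval (blowupAlgebra.frac c j) F) =
      MvPolynomial.aeval (fun k : Fin d => if hk : k = j then (1 : MvPolynomial {k : Fin d // k ≠ j} (ResidueField R)) else X ⟨k, hk⟩) (MvPolynomial.map (residue R) F) := by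
    have hcomp : π.comp (algebraMap R (blowupAlgebra (Ideal.span (Set.range c)) (c j))) =
        (algebraMap (ResidueField R) (MvPolynomial {k : Fin d // k ≠ j} (ResidueField R))).comp (residue R) := by
      ext a
      rw [RingHom.comp_apply, hπalg, RingHom.comp_apply, MvPolynomial.algebraMap_eq]
    have hfun : (fun k : Fin d => π (blowupAlgebra.frac c j k)) =
        fun k : Fin d => if hk : k = j then (1 : MvPolynomial {k : Fin d // k ≠ j} (ResidueField R)) else X ⟨k, hk⟩ := by
      funext k
      by_cases hk : k = j
      · subst hk; rw [dif_pos rfl, hfracj, map_one]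
      · rw [dif_neg hk, hπfrac k hk]
    rw [MvPolynomial.map_aeval, hcomp, hfun, MvPolynomial.aeval_def, MvPolynomial.eval₂_map, MvPolynomial.coe_eval₂Hom]
  -- brick 13 in `B_𝔔` (regular local: Liu 8.1.19 (a) via `IsRegularRing B`)
  haveI := isRegularRing_blowupAlgebra_rsop hd c hc j
  haveI hregL : IsRegularLocalRing (Localization.AtPrime 𝔔) := inferInstance
  obtain ⟨y, hy⟩ : ∃ y : Fin d' → Localization.AtPrime 𝔔, Ideal.span (Set.range y) = maximalIdeal (Localization.AtPrime 𝔔) :=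
    exists_span_range_eq_maximalIdeal (Localization.AtPrime 𝔔) hd'.le
  have hmem : ∀ {z : blowupAlgebra (Ideal.span (Set.range c)) (c j)}, z ∈ 𝔔 →
      algebraMap (blowupAlgebra (Ideal.span (Set.range c)) (c j)) (Localization.AtPrime 𝔔) z ∈ maximalIdeal (Localization.AtPrime 𝔔) :=
    fun {z} hz => (IsLocalization.AtPrime.to_map_mem_maximal_iff (Localization.AtPrime 𝔔) 𝔔 z).mpr hz
  have ht2 := algebraMap_rsop_not_mem_maximalIdeal_sq hd c hc j 𝔔
  have heq := strictTransform_eq_of_cubicForm c hF hFh j hh'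
  have hshape : algebraMap (blowupAlgebra (Ideal.span (Set.range c)) (c j)) (Localization.AtPrime 𝔔) h' =
      algebraMap (blowupAlgebra (Ideal.span (Set.range c)) (c j)) (Localization.AtPrime 𝔔)
          (algebraMap R (blowupAlgebra (Ideal.span (Set.range c)) (c j)) cc) *
        (algebraMap (blowupAlgebra (Ideal.span (Set.range c)) (c j)) (Localization.AtPrime 𝔔) (blowupAlgebra.frac c j i₀) ^ 2 +
          algebraMap (blowupAlgebra (Ideal.span (Set.range c)) (c j)) (Localization.AtPrime 𝔔)
              (algebraMap R (blowupAlgebra (Ideal.span (Set.range c)) (c j)) lam) *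
            algebraMap (blowupAlgebra (Ideal.span (Set.range c)) (c j)) (Localization.AtPrime 𝔔) (blowupAlgebra.frac c j i₁) ^ 2) +
      algebraMap (blowupAlgebra (Ideal.span (Set.range c)) (c j)) (Localization.AtPrime 𝔔)
          (algebraMap R (blowupAlgebra (Ideal.span (Set.range c)) (c j)) (c j)) *
        algebraMap (blowupAlgebra (Ideal.span (Set.range c)) (c j)) (Localization.AtPrime 𝔔)
          (MvPolynomial.aeval (blowupAlgebra.frac c j) F) := by
    conv_lhs => rw [heq]
    simp only [map_add, map_mul, map_pow]
  have hh'3' : algebraMap (blowupAlgebra (Ideal.span (Set.range c)) (c j)) (Localization.AtPrime 𝔔) h' ∉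
      maximalIdeal (Localization.AtPrime 𝔔) ^ (2 + 1) := by
    rw [show (2 + 1 : ℕ) = 3 from rfl]; exact hh'3
  -- (no expected type here: the conclusion is consumed by a lemma over a ring variable, never restated)
  -- (instances passed EXPLICITLY: letting TC re-derive `IsRegularLocalRing B_𝔔` from `IsRegularRing B` does not terminate here)
  have hsq := @mem_span_sup_sq_of_geomDirDim (Localization.AtPrime 𝔔) A _ hregL _ _ _ _ d' hd' y hy σ' hσ' _ hker' hh'2 hh'3' hgeom
    _ _ _ _ _ _ (hmem hu) (hmem hv) (hmem hcj𝔔) ht2 (hmem hG𝔔) hshape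
  -- pushed through the local map `B_𝔔 → κ[T]_𝔭`
  have hL := map_mem_sq_of_mem_span_sup_sq (Localization.localRingHom 𝔔 𝔭 π hcomap.symm)
    (t := algebraMap (blowupAlgebra (Ideal.span (Set.range c)) (c j)) (Localization.AtPrime 𝔔) (algebraMap R (blowupAlgebra (Ideal.span (Set.range c)) (c j)) (c j)))
    (by rw [Localization.localRingHom_to_map, hπcj, map_zero]) hsq
  rw [Localization.localRingHom_to_map] at hL
  exact ⟨π, 𝔭, h𝔭p, hπsurj, hπalg, hπfrac, hπcj, hker, h𝔭, hcomap, hmem𝔭 hu, hmem𝔭 hv, hmem𝔭 hG𝔔, hπG, hL⟩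

end Summit.ResolutionOfSingularities.ResolutionOfSingularities.Cruxes.SigmaMaxModifications.IdeasL1C6.E2Chart

end
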